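import Summits.AtomisticToContinuum.FouriersLaw.Theses.HoelderEscapeProfile
import Summits.AtomisticToContinuum.FouriersLaw.Theses.StaticAbelianSqueeze
import Summits.AtomisticToContinuum.FouriersLaw.Theses.EmbeddedDrudeMourre
import Summits.AtomisticToContinuum.FouriersLaw.Theorems.EmbeddedDrudeMourreAbelThermodynamicLimitOfLowerBound
import Summits.AtomisticToContinuum.FouriersLaw.Theorems.EmbeddedDrudeMourreAbelThermodynamicLimitKaramataRieszTwo
import Summits.AtomisticToContinuum.FouriersLaw.Theorems.StaticAbelianSqueezeUniformAbelianRegularityMonotoneWindow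
import Summits.AtomisticToContinuum.FouriersLaw.Theorems.LatticeLandauDampingAbelThermodynamicLimitAutocorrIntegrableOn

/-!
# Line `abel-summable-splice` — ALTERNATIVE line for the crux `AbelThermodynamicLimit`
(item stmt-AtomisticToContinuum-12596, route HoelderEscapeProfile; `rfl`-twin stmt-14013)

Registrar: planner-cstrat-stmt-AtomisticToContinuum-12596-s2-0 (crux-strategist s2/s3, 2026-08-17).  The lead's skeleton
slot (`Lines/loomis_compact_horizon_witness.lean` rev 5) is NOT touched; this file is published with `ledger crux write`
and its one new stub registered with `workitem stub-add`.

## Idea (one paragraph)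

Every line of this node closes on (R) = `StaticAbelianSqueeze.UniformAbelianRegularity` (stmt-13416).  The live cut of (R)
(13416's line `Sketch`, certificate p152607) is (R) ⇐ `stub_bulkContactSplice` (K3 ∧ K2 ∧ K4) ∧ `stub_postCrossingTails` (K1),
and its wave-2 came back `stub-blocked` on the conjunct **K4 = "the bulk current spectral measure has a density CONTINUOUS AT 0
on a window"**, whose only all-`T` supplier in the tree is LatticeLandauDamping's `WindowDecomposition ∧ NoDrudeWeight`.
K4 is an artefact of the cubic smooth-step window.  Replace the early window by the EXACT three-kernel Riesz combination
`χ(s) = 2(1−2s)₊² − 9(1−4s/3)₊² + 8(1−s)₊²` (`≡ 1` on `[0,½]`, `≡ 0` on `[1,∞)`, `C¹`, antitone): then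
`∫₀^τ χ(t/τ) C = 2R₂(τ/2) − 9R₂(3τ/4) + 8R₂(τ)` with `R₂(T) = ∫₀^T (1−t/T)² C`, so the extensive early bulk term of the
composition is `[2R₂(τ/2) − 9R₂(3τ/4) + 8R₂(τ)] − [A(ν) + O(M/(ν³τ))]`, `A(ν) = ∫₀^∞ e^{−νt} C`.  Hence the ONLY bulk input the
exchange needs is **"the order-2 Riesz means and the Abel means of the bulk correlation `C` converge to a common finite value"**
— no spectral measure, no density, no window.  For a bounded positive-type `C` the Riesz half follows from the Abel half by the
LANDED Karamata lemma `LoomisCompactHorizonWitness.stub_karamataRieszTwo` (p87844, on the PROVED Literature theorem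
`karamata_tauberian_laplace_two`).  That Abelian bulk clause is (i) NECESSARY for (R) (given the landed fixed-frequency matching,
(R) ⟺ common limit, p132484 — so nothing is lost for stmt-13416), and (ii) on THIS route a THEOREM of the route's own engine
cruxes: `HoelderEscapeProfileAbelThermodynamicLimitOfEngine.regularAbelWitness_of_engine` (p157859) + the landed regular-pair
transfer give the regular pair's Abel convergence; CLB is likewise discharged there modulo (R) (`conductanceLowerBound_of_engine`).
So on HoelderEscapeProfile the honest open content of this line is PURELY OPEN-CHAIN: the linear-horizon splice with an `N`-free
Cesàro-small end correction (K3 ∧ K2) and the post-crossing signed tails (K1).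

## Stubs (3; `sorry` only there)
* `stub_abelSummableSplice` — NEW (K3 ∧ K2 ∧ Abelian bulk clause): ∃ bounded measurable positive-type bulk `C` with convergent
  Abel means, an `N`-free locally integrable Cesàro-small `E`, slope `c₀`, with `∫_{(0,c₀N]} |c_N − (N−1)C − E| ≤ K` eventually.
  STRICTLY WEAKER than 13416's `stub_bulkContactSplice` (its σ-representation with a continuous window density gives positive type,
  boundedness and Abel convergence).
* `stub_postCrossingTails` — VERBATIM 13416's registered K1 (one landing serves both chains).
* `stub_conductanceLowerBound` — CLB = `StaticAbelianSqueeze.ConductanceLowerBound` BY NAME (stmt-11749), as loomis rev 5.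

## Sorry-free content
* `early_bulk_window` — the three-kernel Riesz window lemma (pure real analysis, new).
* `uniformAbelianRegularity_of_rieszSummableSplice_and_tails` — CERTIFICATE: (Riesz ∧ Abel)-splice → tails → (R) BY NAME.
* `uniformAbelianRegularity_of_abelSummableSplice_and_tails` — the stub form: `stub_abelSummableSplice`-shape → tails → (R).
* `AbelThermodynamicLimit_of` — the crux `HoelderEscapeProfile.AbelThermodynamicLimit` BY NAME (through p127832), and the
  `EmbeddedDrudeMourre` copy.
-/

noncomputable section

namespace Summit.AtomisticToContinuum.FouriersLaw.Cruxes.AbelThermodynamicLimit.AbelSummableSplice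

open MeasureTheory Set Filter Topology

/-! ## The three-kernel Riesz window `χ(s) = 2(1−2s)₊² − 9(1−4s/3)₊² + 8(1−s)₊²` (a function symbol with its defining equation) -/

section Window

variable (χ : ℝ → ℝ)
  (hχ : ∀ s, χ s = 2 * (max (1 - 2 * s) 0) ^ 2 - 9 * (max (1 - 4 * s / 3) 0) ^ 2 + 8 * (max (1 - s) 0) ^ 2)
include hχ

theorem window_eq_one {s : ℝ} (hs : s ≤ 1 / 2) : χ s = 1 := by
  rw [hχ, max_eq_left (by linarith), max_eq_left (by linarith), max_eq_left (by linarith)]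
  ring

theorem window_eq_mid₁ {s : ℝ} (hs : 1 / 2 ≤ s) (hs' : s ≤ 3 / 4) : χ s = -1 + 8 * s - 8 * s ^ 2 := by
  rw [hχ, max_eq_right (by linarith), max_eq_left (by linarith), max_eq_left (by linarith)]
  ring

theorem window_eq_mid₂ {s : ℝ} (hs : 3 / 4 ≤ s) (hs' : s ≤ 1) : χ s = 8 * (1 - s) ^ 2 := by
  rw [hχ, max_eq_right (by linarith), max_eq_right (by linarith), max_eq_left (by linarith)]
  ring

theorem window_eq_zero {s : ℝ} (hs : 1 ≤ s) : χ s = 0 := by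
  rw [hχ, max_eq_right (by linarith), max_eq_right (by linarith), max_eq_right (by linarith)]
  ring

theorem window_mem_Icc (s : ℝ) : χ s ∈ Icc (0 : ℝ) 1 := by
  rcases le_or_gt s (1 / 2) with h | h
  · rw [window_eq_one χ hχ h]; exact ⟨zero_le_one, le_rfl⟩
  rcases le_or_gt s (3 / 4) with h' | h'
  · rw [window_eq_mid₁ χ hχ h.le h']
    constructor <;> nlinarith
  rcases le_or_gt s 1 with h'' | h''
  · rw [window_eq_mid₂ χ hχ h'.le h'']
    constructor <;> nlinarith
  · rw [window_eq_zero χ hχ h''.le]; exact ⟨le_rfl, zero_le_one⟩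

theorem window_antitone : Antitone χ := by
  intro a b hab
  show χ b ≤ χ a
  rcases le_or_gt b (1 / 2) with hb | hb
  · rw [window_eq_one χ hχ hb, window_eq_one χ hχ (hab.trans hb)]
  rcases le_or_gt a (1 / 2) with ha | ha
  · rw [window_eq_one χ hχ ha]; exact (window_mem_Icc χ hχ b).2
  rcases le_or_gt 1 b with hb1 | hb1
  · rw [window_eq_zero χ hχ hb1]; exact (window_mem_Icc χ hχ a).1
  -- now `1/2 < a ≤ b < 1`
  rcases le_or_gt b (3 / 4) with hb' | hb'
  · rw [window_eq_mid₁ χ hχ hb.le hb', window_eq_mid₁ χ hχ ha.le (hab.trans hb')]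
    nlinarith
  rcases le_or_gt (3 / 4) a with ha' | ha'
  · rw [window_eq_mid₂ χ hχ hb'.le hb1.le, window_eq_mid₂ χ hχ ha' (hab.trans hb1.le)]
    nlinarith
  · rw [window_eq_mid₂ χ hχ hb'.le hb1.le, window_eq_mid₁ χ hχ ha.le ha'.le]
    nlinarith

theorem window_continuous : Continuous χ := by
  rw [show χ = fun s => 2 * (max (1 - 2 * s) 0) ^ 2 - 9 * (max (1 - 4 * s / 3) 0) ^ 2 + 8 * (max (1 - s) 0) ^ 2
    from funext hχ]
  have h1 : Continuous fun s : ℝ => max (1 - 2 * s) 0 := (continuous_const.sub (continuous_const.mul continuous_id)).max continuous_const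
  have h2 : Continuous fun s : ℝ => max (1 - 4 * s / 3) 0 :=
    (continuous_const.sub ((continuous_const.mul continuous_id).div_const _)).max continuous_const
  have h3 : Continuous fun s : ℝ => max (1 - s) 0 := (continuous_const.sub continuous_id).max continuous_const
  exact ((continuous_const.mul (h1.pow 2)).sub (continuous_const.mul (h2.pow 2))).add (continuous_const.mul (h3.pow 2))

end Window

/-! ## Riesz pieces: a truncated kernel `(1 − t/T)₊²` inside a longer window is the order-2 Riesz mean at horizon `T` -/

/-- A bounded measurable function is integrable on `(0, τ]`. -/
theorem integrableOn_Ioc_of_bounded {C : ℝ → ℝ} {M : ℝ} (hCm : Measurable C) (hM : ∀ t, |C t| ≤ M) (a τ : ℝ) :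
    IntegrableOn C (Ioc a τ) :=
  Measure.integrableOn_of_bounded (M := M) measure_Ioc_lt_top.ne hCm.aestronglyMeasurable
    (Eventually.of_forall fun t => by rw [Real.norm_eq_abs]; exact hM t)

theorem riesz_piece {C : ℝ → ℝ} {τ T : ℝ} (hC : IntegrableOn C (Ioc 0 τ)) (hT : 0 < T) (hTτ : T ≤ τ) :
    ∫ t in Ioc (0:ℝ) τ, (max (1 - t / T) 0) ^ 2 * C t = ∫ t in Ioc (0:ℝ) T, (1 - t / T) ^ 2 * C t := by
  have hk : Continuous fun t : ℝ => (max (1 - t / T) 0) ^ 2 := ((continuous_const.sub (continuous_id.div_const _)).max continuous_const).pow 2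
  have hkb : ∀ t : ℝ, 0 ≤ t → ‖(max (1 - t / T) 0) ^ 2‖ ≤ 1 := fun t ht => by
    rw [Real.norm_eq_abs, abs_of_nonneg (sq_nonneg _)]
    have h0 : 0 ≤ max (1 - t / T) 0 := le_max_right _ _
    have h1 : max (1 - t / T) 0 ≤ 1 := max_le (by linarith [div_nonneg ht hT.le]) zero_le_one
    nlinarith
  have hint : IntegrableOn (fun t => (max (1 - t / T) 0) ^ 2 * C t) (Ioc 0 τ) := by
    refine Integrable.bdd_mul hC hk.aestronglyMeasurable (c := 1) ?_
    exact (ae_restrict_iff' measurableSet_Ioc).2 (Eventually.of_forall fun t ht => hkb t ht.1.le)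
  rw [← Ioc_union_Ioc_eq_Ioc hT.le hTτ, setIntegral_union (Ioc_disjoint_Ioc_of_le le_rfl) measurableSet_Ioc
    (hint.mono_set (Ioc_subset_Ioc_right hTτ)) (hint.mono_set (Ioc_subset_Ioc_left hT.le))]
  rw [setIntegral_eq_zero_of_forall_eq_zero (t := Ioc T τ) (fun t ht => by
    rw [max_eq_right (by rw [sub_nonpos, le_div_iff₀ hT, one_mul]; exact ht.1.le), zero_pow two_ne_zero, zero_mul]), add_zero]
  refine setIntegral_congr_fun measurableSet_Ioc (fun t ht => ?_)
  rw [max_eq_left (by rw [sub_nonneg, div_le_one hT]; exact ht.2)]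

/-- The three-kernel window against a bounded bulk function is an exact combination of three Riesz means. -/
theorem window_riesz_decomp (χ : ℝ → ℝ)
    (hχ : ∀ s, χ s = 2 * (max (1 - 2 * s) 0) ^ 2 - 9 * (max (1 - 4 * s / 3) 0) ^ 2 + 8 * (max (1 - s) 0) ^ 2)
    {C : ℝ → ℝ} {M : ℝ} (hCm : Measurable C) (hM : ∀ t, |C t| ≤ M) {τ : ℝ} (hτ : 0 < τ) :
    ∫ t in Ioc (0:ℝ) τ, χ (t / τ) * C t =
      2 * (∫ t in Ioc (0:ℝ) (τ / 2), (1 - t / (τ / 2)) ^ 2 * C t)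
        - 9 * (∫ t in Ioc (0:ℝ) (3 * τ / 4), (1 - t / (3 * τ / 4)) ^ 2 * C t)
        + 8 * (∫ t in Ioc (0:ℝ) τ, (1 - t / τ) ^ 2 * C t) := by
  have hC : IntegrableOn C (Ioc 0 τ) := integrableOn_Ioc_of_bounded hCm hM 0 τ
  have hτ0 : τ ≠ 0 := hτ.ne'
  have e1 : ∀ t : ℝ, 1 - 2 * (t / τ) = 1 - t / (τ / 2) := fun t => by field_simp
  have e2 : ∀ t : ℝ, 1 - 4 * (t / τ) / 3 = 1 - t / (3 * τ / 4) := fun t => by field_simp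
  have hpt : ∀ t : ℝ, χ (t / τ) * C t =
      2 * ((max (1 - t / (τ / 2)) 0) ^ 2 * C t) - 9 * ((max (1 - t / (3 * τ / 4)) 0) ^ 2 * C t)
        + 8 * ((max (1 - t / τ) 0) ^ 2 * C t) := fun t => by
    rw [hχ, e1 t, e2 t]; ring
  -- integrability of the three pieces on `(0, τ]`
  have hpiece : ∀ T : ℝ, 0 < T → IntegrableOn (fun t => (max (1 - t / T) 0) ^ 2 * C t) (Ioc 0 τ) := by
    intro T hT
    have hk : Continuous fun t : ℝ => (max (1 - t / T) 0) ^ 2 := ((continuous_const.sub (continuous_id.div_const _)).max continuous_const).pow 2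
    refine Integrable.bdd_mul hC hk.aestronglyMeasurable (c := 1) ?_
    refine (ae_restrict_iff' measurableSet_Ioc).2 (Eventually.of_forall fun t ht => ?_)
    rw [Real.norm_eq_abs, abs_of_nonneg (sq_nonneg _)]
    have h0 : 0 ≤ max (1 - t / T) 0 := le_max_right _ _
    have h1 : max (1 - t / T) 0 ≤ 1 := max_le (by linarith [div_nonneg ht.1.le hT.le]) zero_le_one
    nlinarith
  have i1 : Integrable (fun t => 2 * ((max (1 - t / (τ / 2)) 0) ^ 2 * C t)) (volume.restrict (Ioc (0:ℝ) τ)) :=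
    (hpiece (τ / 2) (by positivity)).const_mul 2
  have i2 : Integrable (fun t => 9 * ((max (1 - t / (3 * τ / 4)) 0) ^ 2 * C t)) (volume.restrict (Ioc (0:ℝ) τ)) :=
    (hpiece (3 * τ / 4) (by positivity)).const_mul 9
  have i3 : Integrable (fun t => 8 * ((max (1 - t / τ) 0) ^ 2 * C t)) (volume.restrict (Ioc (0:ℝ) τ)) :=
    (hpiece τ hτ).const_mul 8
  have i12 : Integrable (fun t => 2 * ((max (1 - t / (τ / 2)) 0) ^ 2 * C t) - 9 * ((max (1 - t / (3 * τ / 4)) 0) ^ 2 * C t))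
      (volume.restrict (Ioc (0:ℝ) τ)) := i1.sub i2
  rw [setIntegral_congr_fun measurableSet_Ioc (fun t _ => hpt t), integral_add i12 i3, integral_sub i1 i2,
    integral_const_mul, integral_const_mul, integral_const_mul,
    riesz_piece hC (by positivity) (by linarith), riesz_piece hC (by positivity) (by linarith),
    riesz_piece hC hτ le_rfl]

/-! ## An elementary exponential bound -/

theorem exp_neg_le_two_div_sq {y : ℝ} (hy : 0 < y) : Real.exp (-y) ≤ 2 / y ^ 2 := by
  have h := Real.quadratic_le_exp_of_nonneg hy.le
  have hy2 : 0 < y ^ 2 / 2 := by positivity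
  have h' : y ^ 2 / 2 ≤ Real.exp y := by linarith
  rw [Real.exp_neg, show (2 : ℝ) / y ^ 2 = (y ^ 2 / 2)⁻¹ by rw [inv_div]]
  exact inv_anti₀ hy2 h'

/-! ## The early bulk window lemma (NEW real analysis; replaces the zero-mean window lemma + K4) -/

/-- **Early bulk window lemma.** For `C` measurable with `|C| ≤ M` whose order-2 Riesz means `∫₀^τ (1−t/τ)² C → Λ`
(`τ → ∞`) and whose Abel means `∫₀^∞ e^{−νt} C → Λ` (`ν ↓ 0`) have a COMMON finite limit: for every `ε > 0` there is
`ν₁ > 0` such that for every `ν ∈ (0, ν₁]` there is `τ₁` with `|∫₀^τ χ(t/τ)(1 − e^{−νt}) C(t) dt| ≤ ε` for all `τ ≥ τ₁`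
(`χ` the three-kernel Riesz window).  Proof: `∫₀^τ χ(t/τ)C = 2R₂(τ/2) − 9R₂(3τ/4) + 8R₂(τ) → Λ`, while
`|∫₀^τ χ(t/τ)e^{−νt}C − A(ν)| ≤ 8M/(ν²τ) + 2M/(ν³τ)` because `χ(t/τ) = 1` for `t ≤ τ/2`. [folklore] -/
theorem early_bulk_window (χ : ℝ → ℝ)
    (hχ : ∀ s, χ s = 2 * (max (1 - 2 * s) 0) ^ 2 - 9 * (max (1 - 4 * s / 3) 0) ^ 2 + 8 * (max (1 - s) 0) ^ 2)
    (C : ℝ → ℝ) (M Λ : ℝ) (hCm : Measurable C) (hM : ∀ t, |C t| ≤ M)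
    (hR : Tendsto (fun τ : ℝ => ∫ t in Ioc (0:ℝ) τ, (1 - t / τ) ^ 2 * C t) atTop (𝓝 Λ))
    (hA : Tendsto (fun ν : ℝ => ∫ t in Ioi (0:ℝ), Real.exp (-(ν * t)) * C t) (𝓝[>] 0) (𝓝 Λ)) :
    ∀ ε : ℝ, 0 < ε → ∃ ν₁ : ℝ, 0 < ν₁ ∧ ∀ ν : ℝ, 0 < ν → ν ≤ ν₁ → ∃ τ₁ : ℝ, 0 < τ₁ ∧ ∀ τ : ℝ, τ₁ ≤ τ →
      |∫ t in Ioc (0:ℝ) τ, (χ (t / τ) * (1 - Real.exp (-(ν * t)))) * C t| ≤ ε := by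
  intro ε hε
  have hM0 : 0 ≤ M := (abs_nonneg _).trans (hM 0)
  have hχI : ∀ s, χ s ∈ Icc (0:ℝ) 1 := window_mem_Icc χ hχ
  have hχcont : Continuous χ := window_continuous χ hχ
  -- Abel: `|A(ν) − Λ| < ε/3` for `0 < ν ≤ ν₁`
  obtain ⟨δ, hδ, hAδ⟩ := (Metric.tendsto_nhdsWithin_nhds.1 hA) (ε / 3) (by positivity)
  refine ⟨δ / 2, by positivity, fun ν hν hνle => ?_⟩
  set A : ℝ := ∫ t in Ioi (0:ℝ), Real.exp (-(ν * t)) * C t with hA_def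
  have hAν : |A - Λ| < ε / 3 := by
    have h := @hAδ ν (show ν ∈ Ioi (0:ℝ) from hν) (by rw [dist_zero_right, Real.norm_eq_abs, abs_of_pos hν]; linarith)
    rwa [Real.dist_eq] at h
  -- Riesz: the three-kernel combination tends to `Λ`
  set R : ℝ → ℝ := fun T => ∫ t in Ioc (0:ℝ) T, (1 - t / T) ^ 2 * C t with hR_def
  have h2 : Tendsto (fun τ : ℝ => R (τ / 2)) atTop (𝓝 Λ) := hR.comp (Tendsto.atTop_div_const (by norm_num) tendsto_id)
  have h34 : Tendsto (fun τ : ℝ => R (3 * τ / 4)) atTop (𝓝 Λ) :=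
    hR.comp (Tendsto.atTop_div_const (by norm_num) (Tendsto.const_mul_atTop (by norm_num) tendsto_id))
  have hcomb : Tendsto (fun τ : ℝ => 2 * R (τ / 2) - 9 * R (3 * τ / 4) + 8 * R τ) atTop (𝓝 (2 * Λ - 9 * Λ + 8 * Λ)) :=
    ((h2.const_mul 2).sub (h34.const_mul 9)).add (hR.const_mul 8)
  rw [show 2 * Λ - 9 * Λ + 8 * Λ = Λ by ring] at hcomb
  obtain ⟨τa, hτa⟩ := (Metric.tendsto_atTop.1 hcomb) (ε / 3) (by positivity)
  -- the exponential error threshold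
  set τb : ℝ := 48 * (M + 1) / (ε * ν ^ 2) + 48 * (M + 1) / (ε * ν ^ 3) with hτb_def
  have hτb0 : 0 < τb := by positivity
  refine ⟨max (max τa τb) 1, lt_max_of_lt_right one_pos, fun τ hτ => ?_⟩
  have hτa' : τa ≤ τ := le_trans (le_trans (le_max_left _ _) (le_max_left _ _)) hτ
  have hτb' : τb ≤ τ := le_trans (le_trans (le_max_right _ _) (le_max_left _ _)) hτ
  have hτ1 : (1:ℝ) ≤ τ := le_trans (le_max_right _ _) hτ
  have hτ0 : 0 < τ := by linarith
  -- integrability facts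
  have hCint : IntegrableOn C (Ioc 0 τ) := integrableOn_Ioc_of_bounded hCm hM 0 τ
  have hexpint : ∀ a : ℝ, IntegrableOn (fun t : ℝ => Real.exp (-(ν * t))) (Ioi a) := fun a => by
    have h := exp_neg_integrableOn_Ioi a hν
    refine h.congr_fun (fun t _ => ?_) measurableSet_Ioi
    show Real.exp (-ν * t) = Real.exp (-(ν * t))
    rw [neg_mul]
  have heC : ∀ a : ℝ, IntegrableOn (fun t : ℝ => Real.exp (-(ν * t)) * C t) (Ioi a) := fun a => by
    have h := Integrable.bdd_mul (hexpint a) hCm.aestronglyMeasurable (c := M)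
      (Eventually.of_forall fun t => by rw [Real.norm_eq_abs]; exact hM t)
    exact h.congr (Eventually.of_forall fun t => mul_comm _ _)
  have hχτcont : Continuous fun t : ℝ => χ (t / τ) := hχcont.comp (continuous_id.div_const _)
  have hχC : IntegrableOn (fun t => χ (t / τ) * C t) (Ioc 0 τ) := by
    refine Integrable.bdd_mul hCint hχτcont.aestronglyMeasurable (c := 1) ?_
    exact Eventually.of_forall fun t => by
      rw [Real.norm_eq_abs, abs_of_nonneg (hχI _).1]; exact (hχI _).2
  have hχeC : IntegrableOn (fun t => χ (t / τ) * (Real.exp (-(ν * t)) * C t)) (Ioc 0 τ) := by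
    refine Integrable.bdd_mul ((heC 0).mono_set Ioc_subset_Ioi_self) hχτcont.aestronglyMeasurable (c := 1) ?_
    exact Eventually.of_forall fun t => by
      rw [Real.norm_eq_abs, abs_of_nonneg (hχI _).1]; exact (hχI _).2
  -- split the window integral: `∫ χ(1−e)C = ∫ χ C − ∫ χ e C`
  have hsplit : ∫ t in Ioc (0:ℝ) τ, (χ (t / τ) * (1 - Real.exp (-(ν * t)))) * C t =
      (∫ t in Ioc (0:ℝ) τ, χ (t / τ) * C t) - ∫ t in Ioc (0:ℝ) τ, χ (t / τ) * (Real.exp (-(ν * t)) * C t) := by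
    rw [← integral_sub hχC hχeC]
    refine integral_congr_ae (ae_of_all _ fun t => ?_)
    ring
  -- (a) the Riesz identification
  have hTχ : ∫ t in Ioc (0:ℝ) τ, χ (t / τ) * C t = 2 * R (τ / 2) - 9 * R (3 * τ / 4) + 8 * R τ := by
    simp only [hR_def]
    exact window_riesz_decomp χ hχ hCm hM hτ0
  have hTχ_bd : |(∫ t in Ioc (0:ℝ) τ, χ (t / τ) * C t) - Λ| < ε / 3 := by
    rw [hTχ, ← Real.dist_eq]; exact hτa τ hτa'
  -- (b) the Abel identification up to an exponentially small error
  have hA_split : A = (∫ t in Ioc (0:ℝ) τ, Real.exp (-(ν * t)) * C t) + ∫ t in Ioi τ, Real.exp (-(ν * t)) * C t := by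
    simp only [hA_def]
    rw [← Ioc_union_Ioi_eq_Ioi hτ0.le, setIntegral_union (Ioc_disjoint_Ioi le_rfl) measurableSet_Ioi
      ((heC 0).mono_set Ioc_subset_Ioi_self) ((heC 0).mono_set (Ioi_subset_Ioi hτ0.le))]
  have hy : 0 < ν * τ / 2 := by positivity
  have hexp_half : Real.exp (-(ν * τ / 2)) ≤ 8 / (ν ^ 2 * τ ^ 2) := by
    have h := exp_neg_le_two_div_sq hy
    calc Real.exp (-(ν * τ / 2)) ≤ 2 / (ν * τ / 2) ^ 2 := h
      _ = 8 / (ν ^ 2 * τ ^ 2) := by field_simp; ring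
  -- part 1: `|∫_{(0,τ]} (χ(t/τ) − 1) e^{−νt} C| ≤ M e^{−ντ/2} τ ≤ 8M/(ν²τ)`
  have hpart1 : |(∫ t in Ioc (0:ℝ) τ, χ (t / τ) * (Real.exp (-(ν * t)) * C t)) -
      ∫ t in Ioc (0:ℝ) τ, Real.exp (-(ν * t)) * C t| ≤ 8 * M / (ν ^ 2 * τ) := by
    rw [← integral_sub hχeC ((heC 0).mono_set Ioc_subset_Ioi_self)]
    have hbound : ∀ t ∈ Ioc (0:ℝ) τ, ‖χ (t / τ) * (Real.exp (-(ν * t)) * C t) - Real.exp (-(ν * t)) * C t‖ ≤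
        M * Real.exp (-(ν * τ / 2)) := by
      intro t ht
      rw [Real.norm_eq_abs, show χ (t / τ) * (Real.exp (-(ν * t)) * C t) - Real.exp (-(ν * t)) * C t =
        (χ (t / τ) - 1) * (Real.exp (-(ν * t)) * C t) by ring]
      by_cases hth : t ≤ τ / 2
      · have h1 : χ (t / τ) = 1 := window_eq_one χ hχ (by rw [div_le_iff₀ hτ0]; linarith)
        rw [h1, sub_self, zero_mul, abs_zero]; positivity
      · push Not at hth
        rw [abs_mul, abs_mul, abs_of_pos (Real.exp_pos _)]
        have hχ1 : |χ (t / τ) - 1| ≤ 1 := by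
          rw [abs_sub_comm, abs_of_nonneg (by linarith [(hχI (t / τ)).2])]; linarith [(hχI (t / τ)).1]
        have he : Real.exp (-(ν * t)) ≤ Real.exp (-(ν * τ / 2)) := Real.exp_le_exp.2 (by nlinarith)
        calc |χ (t / τ) - 1| * (Real.exp (-(ν * t)) * |C t|) ≤ 1 * (Real.exp (-(ν * τ / 2)) * M) := by
              gcongr
              exact hM t
          _ = M * Real.exp (-(ν * τ / 2)) := by ring
    have h := norm_setIntegral_le_of_norm_le_const (measure_Ioc_lt_top (μ := (volume : Measure ℝ))) hbound
    rw [Real.norm_eq_abs, Real.volume_real_Ioc_of_le hτ0.le, sub_zero] at h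
    calc |∫ t in Ioc (0:ℝ) τ, χ (t / τ) * (Real.exp (-(ν * t)) * C t) - Real.exp (-(ν * t)) * C t|
        ≤ M * Real.exp (-(ν * τ / 2)) * τ := h
      _ ≤ M * (8 / (ν ^ 2 * τ ^ 2)) * τ := by gcongr
      _ = 8 * M / (ν ^ 2 * τ) := by field_simp
  -- part 2: the tail `|∫_{(τ,∞)} e^{−νt} C| ≤ M e^{−ντ}/ν ≤ 8M/(ν³τ)`
  have hpart2 : |∫ t in Ioi τ, Real.exp (-(ν * t)) * C t| ≤ 8 * M / (ν ^ 3 * τ) := by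
    have hg : IntegrableOn (fun t : ℝ => M * Real.exp (-(ν * t))) (Ioi τ) := (hexpint τ).const_mul M
    have hle : ∀ᵐ t ∂(volume.restrict (Ioi τ)), ‖Real.exp (-(ν * t)) * C t‖ ≤ M * Real.exp (-(ν * t)) :=
      Eventually.of_forall fun t => by
        rw [Real.norm_eq_abs, abs_mul, abs_of_pos (Real.exp_pos _), mul_comm]
        exact mul_le_mul_of_nonneg_right (hM t) (Real.exp_pos _).le
    have h := norm_integral_le_of_norm_le hg hle
    rw [Real.norm_eq_abs] at h
    have hval : ∫ t in Ioi τ, M * Real.exp (-(ν * t)) = M * (Real.exp (-(ν * τ)) / ν) := by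
      rw [integral_const_mul]
      congr 1
      have h' := integral_exp_mul_Ioi (show -ν < 0 by linarith) τ
      have h'' : ∫ t in Ioi τ, Real.exp (-(ν * t)) = ∫ t in Ioi τ, Real.exp (-ν * t) :=
        setIntegral_congr_fun measurableSet_Ioi (fun t _ => by rw [neg_mul])
      rw [h'', h', neg_mul]
      field_simp
    rw [hval] at h
    have hexp_full : Real.exp (-(ν * τ)) ≤ Real.exp (-(ν * τ / 2)) := Real.exp_le_exp.2 (by nlinarith)
    have hττ : τ ≤ τ ^ 2 := by nlinarith
    have hτsq : ν ^ 3 * τ ≤ ν ^ 3 * τ ^ 2 := mul_le_mul_of_nonneg_left hττ (pow_pos hν 3).le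
    calc |∫ t in Ioi τ, Real.exp (-(ν * t)) * C t| ≤ M * (Real.exp (-(ν * τ)) / ν) := h
      _ ≤ M * ((8 / (ν ^ 2 * τ ^ 2)) / ν) := by gcongr; exact hexp_full.trans hexp_half
      _ = 8 * M / (ν ^ 3 * τ ^ 2) := by field_simp
      _ ≤ 8 * M / (ν ^ 3 * τ) := div_le_div_of_nonneg_left (by positivity) (by positivity) hτsq
  -- the two error terms are `≤ ε/6` each, by the choice of `τb`
  have hA1 : 48 * (M + 1) / (ε * ν ^ 2) ≤ τ := le_trans (le_add_of_nonneg_right (by positivity)) hτb'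
  have hA2 : 48 * (M + 1) / (ε * ν ^ 3) ≤ τ := le_trans (le_add_of_nonneg_left (by positivity)) hτb'
  rw [div_le_iff₀ (by positivity)] at hA1 hA2
  have herr1 : 8 * M / (ν ^ 2 * τ) ≤ ε / 6 := by
    rw [div_le_iff₀ (by positivity)]
    have : ε / 6 * (ν ^ 2 * τ) = τ * (ε * ν ^ 2) / 6 := by ring
    rw [this]; linarith
  have herr2 : 8 * M / (ν ^ 3 * τ) ≤ ε / 6 := by
    rw [div_le_iff₀ (by positivity)]
    have : ε / 6 * (ν ^ 3 * τ) = τ * (ε * ν ^ 3) / 6 := by ring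
    rw [this]; linarith
  -- assemble
  set X : ℝ := ∫ t in Ioc (0:ℝ) τ, χ (t / τ) * C t with hX
  set Y : ℝ := ∫ t in Ioc (0:ℝ) τ, χ (t / τ) * (Real.exp (-(ν * t)) * C t) with hY
  set Z : ℝ := ∫ t in Ioc (0:ℝ) τ, Real.exp (-(ν * t)) * C t with hZ
  set V : ℝ := ∫ t in Ioi τ, Real.exp (-(ν * t)) * C t with hV
  have hAY : |A - Y| ≤ ε / 6 + ε / 6 := by
    rw [abs_sub_comm, show Y - A = (Y - Z) - V by rw [hA_split]; ring]
    calc |(Y - Z) - V| ≤ |Y - Z| + |V| := abs_sub _ _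
      _ ≤ 8 * M / (ν ^ 2 * τ) + 8 * M / (ν ^ 3 * τ) := add_le_add hpart1 hpart2
      _ ≤ ε / 6 + ε / 6 := add_le_add herr1 herr2
  rw [hsplit]
  calc |X - Y| = |(X - Λ) + (Λ - A) + (A - Y)| := by ring_nf
    _ ≤ |X - Λ| + |Λ - A| + |A - Y| := abs_add_three _ _ _
    _ ≤ ε / 3 + ε / 3 + (ε / 6 + ε / 6) :=
        add_le_add (add_le_add hTχ_bd.le (by rw [abs_sub_comm]; exact hAν.le)) hAY
    _ = ε := by ring


/-! ## Registered stubs (`sorry` only here) -/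

/-- **stub `stub_abelSummableSplice` (K3 ∧ K2 ∧ Abelian bulk clause; physical, XL; OPEN, NEW).**  For `pinnedChain ω₂ lam β γ`
(all `> 0`) and `T > 0` there are: a bounded measurable bulk function `C` (`|C| ≤ M`) of POSITIVE TYPE in doubly-integrated form
(`∫₀ᵗ (t−u) C(u) du ≥ 0`, as delivered for every witness by `stub_witnessPositiveType`) whose ABEL MEANS CONVERGE
(`∫₀^∞ e^{−νt} C → Λ`, `ν ↓ 0`; for the natural `C` = the regular pair's summed current correlation this is bulk Abelian Green–Kubo
existence — (R)-NECESSARY given the landed matching, and on route HoelderEscapeProfile a theorem of its engine cruxes, p157859);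
an `N`-free, locally integrable end correction `E` with Cesàro-small mass `∫₀^τ |E| ≤ ετ` (`τ ≥ τ₀(ε)`); a cone slope `c₀ > 0`,
`K ≥ 0`, `N₁`, such that the light-cone splice holds in integrated form up to the linear horizon:
`∫_{(0, c₀N]} |c_N(t) − (N−1) C(t) − E(t)| dt ≤ K` for all `N ≥ N₁`.  No spectral measure, no density, no window (cf. 13416's
`stub_bulkContactSplice`, which this weakens). -/
theorem stub_abelSummableSplice :
    ∀ ω₂ lam β γ : ℝ, 0 < ω₂ → 0 < lam → 0 < β → 0 < γ → ∀ T : ℝ, 0 < T →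
      ∃ (C E : ℝ → ℝ) (M Λ c₀ K : ℝ) (N₁ : ℕ),
        0 < c₀ ∧ 0 ≤ K ∧ Measurable C ∧ Measurable E ∧ (∀ t : ℝ, |C t| ≤ M) ∧
        (∀ t : ℝ, 0 ≤ t → 0 ≤ ∫ u in Set.Ioc (0:ℝ) t, (t - u) * C u) ∧
        Filter.Tendsto (fun ν : ℝ => ∫ t in Set.Ioi (0:ℝ), Real.exp (-(ν * t)) * C t) (nhdsWithin (0:ℝ) (Set.Ioi 0)) (nhds Λ) ∧
        (∀ τ : ℝ, 0 < τ → MeasureTheory.IntegrableOn E (Set.Ioc 0 τ)) ∧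
        (∀ ε : ℝ, 0 < ε → ∃ τ₀ : ℝ, 0 < τ₀ ∧ ∀ τ : ℝ, τ₀ ≤ τ → ∫ t in Set.Ioc 0 τ, |E t| ≤ ε * τ) ∧
        (∀ N : ℕ, N₁ ≤ N → let J : Literature.MathematicalPhysics.KineticTheory.HeatConduction.PhaseSpace N → ℝ := fun z => ∑ i : Fin N, (Literature.MathematicalPhysics.KineticTheory.HeatConduction.pinnedChain ω₂ lam β γ).bondCurrent N i z; ∫ t in Set.Ioc 0 (c₀ * N), |(∫ z, J z * (∫ y, J y ∂((Literature.MathematicalPhysics.KineticTheory.HeatConduction.pinnedChain ω₂ lam β γ).transitionKernel N T T t.toNNReal z)) ∂((Literature.MathematicalPhysics.KineticTheory.HeatConduction.pinnedChain ω₂ lam β γ).gibbsMeasure N T)) - ((N:ℝ) - 1) * C t - E t| ≤ K) := by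
  sorry

/-- **stub `stub_postCrossingTails` (K1, `ε`-form; physical, XL; OPEN) — VERBATIM the registered stub of stmt-13416's line `Sketch`.**
For `pinnedChain ω₂ lam β γ` (all `> 0`), `T > 0`, every slope `c₀ > 0` and `ε > 0` there is `N₀` such that for all `N ≥ N₀` and all
`ξ ≥ c₀ N` the SIGNED Green–Kubo tail obeys `|∫_{(ξ,∞)} c_N(s) ds| ≤ ε N`.  `ν`-free, signed, single chain; false at the harmonic corner. -/
theorem stub_postCrossingTails :
    ∀ ω₂ lam β γ : ℝ, 0 < ω₂ → 0 < lam → 0 < β → 0 < γ → ∀ T : ℝ, 0 < T → ∀ c₀ : ℝ, 0 < c₀ → ∀ ε : ℝ, 0 < ε →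
      ∃ N₀ : ℕ, ∀ N : ℕ, N₀ ≤ N → ∀ ξ : ℝ, c₀ * N ≤ ξ → let J : Literature.MathematicalPhysics.KineticTheory.HeatConduction.PhaseSpace N → ℝ := fun z => ∑ i : Fin N, (Literature.MathematicalPhysics.KineticTheory.HeatConduction.pinnedChain ω₂ lam β γ).bondCurrent N i z; |∫ s in Set.Ioi ξ, ∫ z, J z * (∫ y, J y ∂((Literature.MathematicalPhysics.KineticTheory.HeatConduction.pinnedChain ω₂ lam β γ).transitionKernel N T T s.toNNReal z)) ∂((Literature.MathematicalPhysics.KineticTheory.HeatConduction.pinnedChain ω₂ lam β γ).gibbsMeasure N T)| ≤ ε * N := by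
  sorry

/-- **stub `stub_conductanceLowerBound` — CLB = `StaticAbelianSqueeze.ConductanceLowerBound` BY NAME (item stmt-11749; OPEN, led in
its own chain; on route HoelderEscapeProfile discharged modulo (R) by `conductanceLowerBound_of_engine`, p157859).**  Under weak-NESS
uniqueness, for every steady-state family, `T > 0` and response coefficients `D_N`: `∃ c > 0 ∃ N₁ ∀ N ≥ N₁, c ≤ D_N`.  Used once, as in
loomis rev 5 / p127832, to make the common limit positive. -/
theorem stub_conductanceLowerBound :
    Summit.AtomisticToContinuum.FouriersLaw.Theses.StaticAbelianSqueeze.ConductanceLowerBound := by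
  sorry

/-! ## The certificate: (R) from a Riesz/Abel-summable splice and post-crossing tails -/

/-- **(R) ⇐ (Riesz ∧ Abel)-summable splice ∧ post-crossing signed tails** (sorry-free; the three-kernel Riesz window at the linear
horizon `c₀N`).  The splice hypothesis carries the bulk only through `|C| ≤ M`, `∫₀^τ (1−t/τ)² C → Λ` and `∫₀^∞ e^{−νt} C → Λ`. [folklore] -/
theorem uniformAbelianRegularity_of_rieszSummableSplice_and_tails :
    (∀ ω₂ lam β γ : ℝ, 0 < ω₂ → 0 < lam → 0 < β → 0 < γ → ∀ T : ℝ, 0 < T →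
      ∃ (C E : ℝ → ℝ) (M Λ c₀ K : ℝ) (N₁ : ℕ),
        0 < c₀ ∧ 0 ≤ K ∧ Measurable C ∧ Measurable E ∧ (∀ t : ℝ, |C t| ≤ M) ∧
        Filter.Tendsto (fun τ : ℝ => ∫ t in Set.Ioc (0:ℝ) τ, (1 - t / τ) ^ 2 * C t) Filter.atTop (nhds Λ) ∧
        Filter.Tendsto (fun ν : ℝ => ∫ t in Set.Ioi (0:ℝ), Real.exp (-(ν * t)) * C t) (nhdsWithin (0:ℝ) (Set.Ioi 0)) (nhds Λ) ∧
        (∀ τ : ℝ, 0 < τ → MeasureTheory.IntegrableOn E (Set.Ioc 0 τ)) ∧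
        (∀ ε : ℝ, 0 < ε → ∃ τ₀ : ℝ, 0 < τ₀ ∧ ∀ τ : ℝ, τ₀ ≤ τ → ∫ t in Set.Ioc 0 τ, |E t| ≤ ε * τ) ∧
        (∀ N : ℕ, N₁ ≤ N → let J : Literature.MathematicalPhysics.KineticTheory.HeatConduction.PhaseSpace N → ℝ := fun z => ∑ i : Fin N, (Literature.MathematicalPhysics.KineticTheory.HeatConduction.pinnedChain ω₂ lam β γ).bondCurrent N i z; ∫ t in Set.Ioc 0 (c₀ * N), |(∫ z, J z * (∫ y, J y ∂((Literature.MathematicalPhysics.KineticTheory.HeatConduction.pinnedChain ω₂ lam β γ).transitionKernel N T T t.toNNReal z)) ∂((Literature.MathematicalPhysics.KineticTheory.HeatConduction.pinnedChain ω₂ lam β γ).gibbsMeasure N T)) - ((N:ℝ) - 1) * C t - E t| ≤ K)) →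
    (∀ ω₂ lam β γ : ℝ, 0 < ω₂ → 0 < lam → 0 < β → 0 < γ → ∀ T : ℝ, 0 < T → ∀ c₀ : ℝ, 0 < c₀ → ∀ ε : ℝ, 0 < ε →
      ∃ N₀ : ℕ, ∀ N : ℕ, N₀ ≤ N → ∀ ξ : ℝ, c₀ * N ≤ ξ → let J : Literature.MathematicalPhysics.KineticTheory.HeatConduction.PhaseSpace N → ℝ := fun z => ∑ i : Fin N, (Literature.MathematicalPhysics.KineticTheory.HeatConduction.pinnedChain ω₂ lam β γ).bondCurrent N i z; |∫ s in Set.Ioi ξ, ∫ z, J z * (∫ y, J y ∂((Literature.MathematicalPhysics.KineticTheory.HeatConduction.pinnedChain ω₂ lam β γ).transitionKernel N T T s.toNNReal z)) ∂((Literature.MathematicalPhysics.KineticTheory.HeatConduction.pinnedChain ω₂ lam β γ).gibbsMeasure N T)| ≤ ε * N) →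
    _root_.Summit.AtomisticToContinuum.FouriersLaw.Theses.StaticAbelianSqueeze.UniformAbelianRegularity := by
  intro h1 h3 ω₂ lam β γ hω hl hβ hγ T hT ε hε
  obtain ⟨C, E, M, Λ, c₀, K, N₁, hc₀, hK, hCm, hEm, hM, hRz, hAb, hEint, hCes, hmatch⟩ := h1 ω₂ lam β γ hω hl hβ hγ T hT
  have hε8 : 0 < ε / 8 := by positivity
  -- the three-kernel Riesz window
  set χ : ℝ → ℝ := fun s => 2 * (max (1 - 2 * s) 0) ^ 2 - 9 * (max (1 - 4 * s / 3) 0) ^ 2 + 8 * (max (1 - s) 0) ^ 2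
    with hχ_def
  have hχ : ∀ s, χ s = 2 * (max (1 - 2 * s) 0) ^ 2 - 9 * (max (1 - 4 * s / 3) 0) ^ 2 + 8 * (max (1 - s) 0) ^ 2 :=
    fun s => rfl
  have hχI : ∀ s, χ s ∈ Icc (0:ℝ) 1 := window_mem_Icc χ hχ
  have hχanti : Antitone χ := window_antitone χ hχ
  have hχcont : Continuous χ := window_continuous χ hχ
  have hχ_one : ∀ s : ℝ, s ≤ 1 / 2 → χ s = 1 := fun s hs => window_eq_one χ hχ hs
  have hχ_zero : ∀ s : ℝ, 1 ≤ s → χ s = 0 := fun s hs => window_eq_zero χ hχ hs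
  -- early bulk window lemma: `ν₁`
  obtain ⟨ν₁, hν₁, hEB⟩ := early_bulk_window χ hχ C M Λ hCm hM hRz hAb (ε / 8) hε8
  obtain ⟨τ₀, hτ₀, hCes'⟩ := hCes (ε / (8 * c₀)) (by positivity)
  refine ⟨min ν₁ 1, lt_min hν₁ one_pos, fun ν hν hνlt => ?_⟩
  have hνν₁ : ν ≤ ν₁ := (hνlt.trans_le (min_le_left _ _)).le
  obtain ⟨τ₁, hτ₁, hC_bd'⟩ := hEB ν hν hνν₁
  obtain ⟨N₃, hN₃⟩ := h3 ω₂ lam β γ hω hl hβ hγ T hT (c₀ / 2) (by positivity) (ε / 8) hε8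
  refine ⟨max (max N₁ N₃) (⌈max τ₀ τ₁ / c₀⌉₊ + ⌈8 * K / ε⌉₊ + 1), fun N hN => ?_⟩
  have hN₁N : N₁ ≤ N := le_trans (le_trans (le_max_left _ _) (le_max_left _ _)) hN
  have hN₃N : N₃ ≤ N := le_trans (le_trans (le_max_right _ _) (le_max_left _ _)) hN
  have hbig : ⌈max τ₀ τ₁ / c₀⌉₊ + ⌈8 * K / ε⌉₊ + 1 ≤ N := le_trans (le_max_right _ _) hN
  have hN1 : 1 ≤ N := by omega
  have hNr1 : (1:ℝ) ≤ N := by exact_mod_cast hN1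
  have hNr0 : (0:ℝ) ≤ N := Nat.cast_nonneg N
  have hτN : max τ₀ τ₁ ≤ c₀ * N := by
    have h1' : max τ₀ τ₁ / c₀ ≤ ⌈max τ₀ τ₁ / c₀⌉₊ := Nat.le_ceil _
    have h2' : (⌈max τ₀ τ₁ / c₀⌉₊ : ℝ) ≤ N := by exact_mod_cast (by omega : ⌈max τ₀ τ₁ / c₀⌉₊ ≤ N)
    have h3' := (div_le_iff₀ hc₀).1 (h1'.trans h2')
    linarith [mul_comm (N:ℝ) c₀]
  have hKN : K ≤ ε / 8 * N := by
    have h1' : 8 * K / ε ≤ ⌈8 * K / ε⌉₊ := Nat.le_ceil _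
    have h2' : (⌈8 * K / ε⌉₊ : ℝ) ≤ N := by exact_mod_cast (by omega : ⌈8 * K / ε⌉₊ ≤ N)
    have h3' := (div_le_iff₀ hε).1 (h1'.trans h2')
    nlinarith
  intro J
  set P := Literature.MathematicalPhysics.KineticTheory.HeatConduction.pinnedChain ω₂ lam β γ with hP_def
  -- the autocorrelation `c_N`
  set cN : ℝ → ℝ := fun t => ∫ z, J z * (∫ y, J y ∂(P.transitionKernel N T T t.toNNReal z)) ∂(P.gibbsMeasure N T)
    with hcN_def
  show |∫ t in Set.Ioi (0:ℝ), (1 - Real.exp (-(ν * t))) * cN t| ≤ ε * N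
  -- fixed-`N` integrability (LANDED, p144688)
  have hint : IntegrableOn cN (Ioi 0) :=
    Summit.AtomisticToContinuum.FouriersLaw.Theorems.AbelThermodynamicLimit.SeriesLawAtEveryLaplaceFrequency.stub_autocorrIntegrableOn
      ω₂ lam β γ hω hl hβ hγ T hT N
  -- the horizon
  set τ : ℝ := c₀ * N with hτ_def
  have hτ0 : 0 < τ := by positivity
  have hττ₀ : τ₀ ≤ τ := le_trans (le_max_left _ _) hτN
  have hττ₁ : τ₁ ≤ τ := le_trans (le_max_right _ _) hτN
  -- the windows
  set W : ℝ → ℝ := fun t => χ (t / τ) * (1 - Real.exp (-(ν * t))) with hW_def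
  set L : ℝ → ℝ := fun t => (1 - χ (t / τ)) * (1 - Real.exp (-(ν * t))) with hL_def
  have hw0 : ∀ t : ℝ, 0 < t → 0 ≤ 1 - Real.exp (-(ν * t)) := fun t ht => by
    have h : Real.exp (-(ν * t)) ≤ 1 := Real.exp_le_one_iff.2 (by nlinarith [mul_pos hν ht])
    linarith
  have hw1 : ∀ t : ℝ, 1 - Real.exp (-(ν * t)) ≤ 1 := fun t => by linarith [Real.exp_pos (-(ν * t))]
  have hWcont : Continuous W := (hχcont.comp (continuous_id.div_const τ)).mul (by fun_prop)
  have hLcont : Continuous L := (continuous_const.sub (hχcont.comp (continuous_id.div_const τ))).mul (by fun_prop)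
  have hWbd : ∀ t : ℝ, 0 < t → |W t| ≤ 1 := fun t ht => by
    simp only [hW_def]
    rw [abs_mul, abs_of_nonneg (hχI _).1, abs_of_nonneg (hw0 t ht)]
    exact mul_le_one₀ (hχI _).2 (hw0 t ht) (hw1 t)
  have hWzero : ∀ t : ℝ, τ ≤ t → W t = 0 := fun t ht => by
    have h' : 1 ≤ t / τ := by rwa [le_div_iff₀ hτ0, one_mul]
    simp only [hW_def, hχ_zero _ h', zero_mul]
  have hLzero : ∀ t : ℝ, t ≤ τ / 2 → L t = 0 := fun t ht => by
    have h' : t / τ ≤ 1 / 2 := by rw [div_le_iff₀ hτ0]; linarith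
    simp only [hL_def, hχ_one _ h', sub_self, zero_mul]
  have hLa : L (τ / 2) = 0 := hLzero _ le_rfl
  have hLnn : ∀ t : ℝ, 0 ≤ L t := fun t => by
    by_cases ht : t ≤ τ / 2
    · rw [hLzero t ht]
    · push Not at ht
      have ht0 : 0 < t := by linarith
      exact mul_nonneg (by linarith [(hχI (t / τ)).2]) (hw0 t ht0)
  have hLle : ∀ t : ℝ, L t ≤ 1 := fun t => by
    by_cases ht : t ≤ τ / 2
    · rw [hLzero t ht]; exact zero_le_one
    · push Not at ht
      have ht0 : 0 < t := by linarith
      exact mul_le_one₀ (by linarith [(hχI (t / τ)).1]) (hw0 t ht0) (hw1 t)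
  have hLmono : Monotone L := by
    intro t t' htt'
    by_cases ht : t ≤ τ / 2
    · rw [hLzero t ht]; exact hLnn t'
    · push Not at ht
      have ht0 : 0 < t := by linarith
      have ht'0 : 0 < t' := by linarith
      apply mul_le_mul
      · have : χ (t' / τ) ≤ χ (t / τ) := hχanti (div_le_div_of_nonneg_right htt' hτ0.le)
        linarith
      · have : Real.exp (-(ν * t')) ≤ Real.exp (-(ν * t)) := Real.exp_le_exp.2 (by nlinarith)
        linarith
      · exact hw0 t ht0
      · linarith [(hχI (t' / τ)).2]
  have hWL : ∀ t : ℝ, (1 - Real.exp (-(ν * t))) = W t + L t := fun t => by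
    simp only [hW_def, hL_def]; ring
  -- integrability of the weighted autocorrelation and the split `S_N = ∫ W c_N + ∫ L c_N`
  have hWint : IntegrableOn (fun t => W t * cN t) (Ioi 0) := by
    refine Integrable.bdd_mul hint hWcont.aestronglyMeasurable (c := 1) ?_
    exact (ae_restrict_iff' measurableSet_Ioi).2 (Eventually.of_forall fun t ht => by
      rw [Real.norm_eq_abs]; exact hWbd t ht)
  have hLint : IntegrableOn (fun t => L t * cN t) (Ioi 0) := by
    refine Integrable.bdd_mul hint hLcont.aestronglyMeasurable (c := 1) ?_
    exact Eventually.of_forall fun t => by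
      rw [Real.norm_eq_abs, abs_of_nonneg (hLnn t)]; exact hLle t
  have hsplit : ∫ t in Ioi (0:ℝ), (1 - Real.exp (-(ν * t))) * cN t =
      (∫ t in Ioi (0:ℝ), W t * cN t) + ∫ t in Ioi (0:ℝ), L t * cN t := by
    have hpt : ∀ t, (1 - Real.exp (-(ν * t))) * cN t = W t * cN t + L t * cN t := fun t => by
      rw [hWL t]; ring
    simp_rw [hpt]
    exact integral_add hWint hLint
  -- LATE WINDOW: Bonnet (landed P2 of 13416's line) + post-crossing tails (stub K1)
  have hlate : |∫ t in Ioi (0:ℝ), L t * cN t| ≤ ε / 8 * N := by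
    have hτ2 : (0:ℝ) ≤ τ / 2 := by positivity
    have heq : ∫ t in Ioi (0:ℝ), L t * cN t = ∫ t in Ioi (τ / 2), L t * cN t := by
      rw [← Ioc_union_Ioi_eq_Ioi hτ2, setIntegral_union (Ioc_disjoint_Ioi le_rfl) measurableSet_Ioi
        (hLint.mono_set Ioc_subset_Ioi_self) (hLint.mono_set (Ioi_subset_Ioi hτ2))]
      rw [setIntegral_eq_zero_of_forall_eq_zero (fun t ht => by rw [hLzero t ht.2, zero_mul]), zero_add]
    rw [heq]
    refine Summit.AtomisticToContinuum.FouriersLaw.Theorems.UniformAbelianRegularity.ZeroMeanDyadicSplice.stub_monotoneWindow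
      cN L (τ / 2) (ε / 8 * N) (hint.mono_set (Ioi_subset_Ioi hτ2)) hLmono hLcont hLa hLle ?_
    intro ξ hξ
    have hξ' : c₀ / 2 * N ≤ ξ := by
      have : c₀ / 2 * N = τ / 2 := by simp only [hτ_def]; ring
      linarith
    exact hN₃ N hN₃N ξ hξ'
  -- EARLY WINDOW: splice (stub) + the early bulk window lemma (Riesz/Abel)
  have hCint : IntegrableOn C (Ioc 0 τ) := integrableOn_Ioc_of_bounded hCm hM 0 τ
  have hEint' : IntegrableOn E (Ioc 0 τ) := hEint τ hτ0
  have hcNint' : IntegrableOn cN (Ioc 0 τ) := hint.mono_set Ioc_subset_Ioi_self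
  set R : ℝ → ℝ := fun t => cN t - ((N:ℝ) - 1) * C t - E t with hR_def
  have hRint : IntegrableOn R (Ioc 0 τ) := (hcNint'.sub (hCint.const_mul _)).sub hEint'
  have hmatch' : ∫ t in Ioc (0:ℝ) τ, |R t| ≤ K := hmatch N hN₁N
  have hWbd' : ∀ᵐ t ∂(volume.restrict (Ioc (0:ℝ) τ)), ‖W t‖ ≤ 1 :=
    (ae_restrict_iff' measurableSet_Ioc).2 (Eventually.of_forall fun t ht => by
      rw [Real.norm_eq_abs]; exact hWbd t ht.1)
  have hWC : IntegrableOn (fun t => W t * C t) (Ioc 0 τ) := Integrable.bdd_mul hCint hWcont.aestronglyMeasurable hWbd'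
  have hWE : IntegrableOn (fun t => W t * E t) (Ioc 0 τ) := Integrable.bdd_mul hEint' hWcont.aestronglyMeasurable hWbd'
  have hWR : IntegrableOn (fun t => W t * R t) (Ioc 0 τ) := Integrable.bdd_mul hRint hWcont.aestronglyMeasurable hWbd'
  have hearly_eq : ∫ t in Ioi (0:ℝ), W t * cN t = ∫ t in Ioc (0:ℝ) τ, W t * cN t := by
    rw [← Ioc_union_Ioi_eq_Ioi hτ0.le, setIntegral_union (Ioc_disjoint_Ioi le_rfl) measurableSet_Ioi
      (hWint.mono_set Ioc_subset_Ioi_self) (hWint.mono_set (Ioi_subset_Ioi hτ0.le))]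
    rw [setIntegral_eq_zero_of_forall_eq_zero (t := Ioi τ)
      (fun t ht => by rw [hWzero t (le_of_lt ht), zero_mul]), add_zero]
  have hdecomp : ∫ t in Ioc (0:ℝ) τ, W t * cN t =
      ((N:ℝ) - 1) * (∫ t in Ioc (0:ℝ) τ, W t * C t) + (∫ t in Ioc (0:ℝ) τ, W t * E t) +
        ∫ t in Ioc (0:ℝ) τ, W t * R t := by
    have hpt : ∀ t, W t * cN t = ((N:ℝ) - 1) * (W t * C t) + W t * E t + W t * R t := fun t => by
      simp only [hR_def]; ring
    have i1 : Integrable (fun t => ((N:ℝ) - 1) * (W t * C t)) (volume.restrict (Ioc (0:ℝ) τ)) := hWC.const_mul _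
    have i12 : Integrable (fun t => ((N:ℝ) - 1) * (W t * C t) + W t * E t) (volume.restrict (Ioc (0:ℝ) τ)) :=
      i1.add hWE
    simp_rw [hpt]
    rw [integral_add i12 hWR, integral_add i1 hWE, integral_const_mul]
  have hE_bd : |∫ t in Ioc (0:ℝ) τ, W t * E t| ≤ ε / 8 * N := by
    calc |∫ t in Ioc (0:ℝ) τ, W t * E t| ≤ ∫ t in Ioc (0:ℝ) τ, |W t * E t| := abs_integral_le_integral_abs
      _ ≤ ∫ t in Ioc (0:ℝ) τ, |E t| :=
          setIntegral_mono_on hWE.abs hEint'.abs measurableSet_Ioc (fun t ht => by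
            rw [abs_mul]; exact mul_le_of_le_one_left (abs_nonneg _) (hWbd t ht.1))
      _ ≤ ε / (8 * c₀) * τ := hCes' τ hττ₀
      _ = ε / 8 * N := by simp only [hτ_def]; field_simp
  have hR_bd : |∫ t in Ioc (0:ℝ) τ, W t * R t| ≤ ε / 8 * N := by
    calc |∫ t in Ioc (0:ℝ) τ, W t * R t| ≤ ∫ t in Ioc (0:ℝ) τ, |W t * R t| := abs_integral_le_integral_abs
      _ ≤ ∫ t in Ioc (0:ℝ) τ, |R t| :=
          setIntegral_mono_on hWR.abs hRint.abs measurableSet_Ioc (fun t ht => by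
            rw [abs_mul]; exact mul_le_of_le_one_left (abs_nonneg _) (hWbd t ht.1))
      _ ≤ K := hmatch'
      _ ≤ ε / 8 * N := hKN
  have hC_bd : |∫ t in Ioc (0:ℝ) τ, W t * C t| ≤ ε / 8 := hC_bd' τ hττ₁
  have hearly : |∫ t in Ioi (0:ℝ), W t * cN t| ≤ ((N:ℝ) - 1) * (ε / 8) + ε / 8 * N + ε / 8 * N := by
    rw [hearly_eq, hdecomp]
    have hN1' : (0:ℝ) ≤ (N:ℝ) - 1 := by linarith
    calc |((N:ℝ) - 1) * (∫ t in Ioc (0:ℝ) τ, W t * C t) + (∫ t in Ioc (0:ℝ) τ, W t * E t) +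
            ∫ t in Ioc (0:ℝ) τ, W t * R t|
        ≤ |((N:ℝ) - 1) * ∫ t in Ioc (0:ℝ) τ, W t * C t| + |∫ t in Ioc (0:ℝ) τ, W t * E t| +
            |∫ t in Ioc (0:ℝ) τ, W t * R t| := abs_add_three _ _ _
      _ = ((N:ℝ) - 1) * |∫ t in Ioc (0:ℝ) τ, W t * C t| + |∫ t in Ioc (0:ℝ) τ, W t * E t| +
            |∫ t in Ioc (0:ℝ) τ, W t * R t| := by rw [abs_mul, abs_of_nonneg hN1']
      _ ≤ ((N:ℝ) - 1) * (ε / 8) + ε / 8 * N + ε / 8 * N := by gcongr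
  -- assemble
  rw [hsplit]
  calc |(∫ t in Ioi (0:ℝ), W t * cN t) + ∫ t in Ioi (0:ℝ), L t * cN t|
      ≤ |∫ t in Ioi (0:ℝ), W t * cN t| + |∫ t in Ioi (0:ℝ), L t * cN t| := abs_add_le _ _
    _ ≤ (((N:ℝ) - 1) * (ε / 8) + ε / 8 * N + ε / 8 * N) + ε / 8 * N := add_le_add hearly hlate
    _ ≤ ε * N := by nlinarith

/-- **(R) ⇐ Abel-summable positive-type splice ∧ post-crossing tails** — the registered-stub form: the bulk enters only through
`|C| ≤ M`, positive type, and CONVERGENT ABEL MEANS; the Riesz half is the landed Karamata lemma `stub_karamataRieszTwo` (p87844). -/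
theorem uniformAbelianRegularity_of_abelSummableSplice_and_tails :
    (∀ ω₂ lam β γ : ℝ, 0 < ω₂ → 0 < lam → 0 < β → 0 < γ → ∀ T : ℝ, 0 < T →
      ∃ (C E : ℝ → ℝ) (M Λ c₀ K : ℝ) (N₁ : ℕ),
        0 < c₀ ∧ 0 ≤ K ∧ Measurable C ∧ Measurable E ∧ (∀ t : ℝ, |C t| ≤ M) ∧
        (∀ t : ℝ, 0 ≤ t → 0 ≤ ∫ u in Set.Ioc (0:ℝ) t, (t - u) * C u) ∧
        Filter.Tendsto (fun ν : ℝ => ∫ t in Set.Ioi (0:ℝ), Real.exp (-(ν * t)) * C t) (nhdsWithin (0:ℝ) (Set.Ioi 0)) (nhds Λ) ∧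
        (∀ τ : ℝ, 0 < τ → MeasureTheory.IntegrableOn E (Set.Ioc 0 τ)) ∧
        (∀ ε : ℝ, 0 < ε → ∃ τ₀ : ℝ, 0 < τ₀ ∧ ∀ τ : ℝ, τ₀ ≤ τ → ∫ t in Set.Ioc 0 τ, |E t| ≤ ε * τ) ∧
        (∀ N : ℕ, N₁ ≤ N → let J : Literature.MathematicalPhysics.KineticTheory.HeatConduction.PhaseSpace N → ℝ := fun z => ∑ i : Fin N, (Literature.MathematicalPhysics.KineticTheory.HeatConduction.pinnedChain ω₂ lam β γ).bondCurrent N i z; ∫ t in Set.Ioc 0 (c₀ * N), |(∫ z, J z * (∫ y, J y ∂((Literature.MathematicalPhysics.KineticTheory.HeatConduction.pinnedChain ω₂ lam β γ).transitionKernel N T T t.toNNReal z)) ∂((Literature.MathematicalPhysics.KineticTheory.HeatConduction.pinnedChain ω₂ lam β γ).gibbsMeasure N T)) - ((N:ℝ) - 1) * C t - E t| ≤ K)) →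
    (∀ ω₂ lam β γ : ℝ, 0 < ω₂ → 0 < lam → 0 < β → 0 < γ → ∀ T : ℝ, 0 < T → ∀ c₀ : ℝ, 0 < c₀ → ∀ ε : ℝ, 0 < ε →
      ∃ N₀ : ℕ, ∀ N : ℕ, N₀ ≤ N → ∀ ξ : ℝ, c₀ * N ≤ ξ → let J : Literature.MathematicalPhysics.KineticTheory.HeatConduction.PhaseSpace N → ℝ := fun z => ∑ i : Fin N, (Literature.MathematicalPhysics.KineticTheory.HeatConduction.pinnedChain ω₂ lam β γ).bondCurrent N i z; |∫ s in Set.Ioi ξ, ∫ z, J z * (∫ y, J y ∂((Literature.MathematicalPhysics.KineticTheory.HeatConduction.pinnedChain ω₂ lam β γ).transitionKernel N T T s.toNNReal z)) ∂((Literature.MathematicalPhysics.KineticTheory.HeatConduction.pinnedChain ω₂ lam β γ).gibbsMeasure N T)| ≤ ε * N) →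
    _root_.Summit.AtomisticToContinuum.FouriersLaw.Theses.StaticAbelianSqueeze.UniformAbelianRegularity := by
  intro h1 h3
  refine uniformAbelianRegularity_of_rieszSummableSplice_and_tails (fun ω₂ lam β γ hω hl hβ hγ T hT => ?_) h3
  obtain ⟨C, E, M, Λ, c₀, K, N₁, hc₀, hK, hCm, hEm, hM, hV, hAb, hEint, hCes, hmatch⟩ := h1 ω₂ lam β γ hω hl hβ hγ T hT
  exact ⟨C, E, M, Λ, c₀, K, N₁, hc₀, hK, hCm, hEm, hM,
    Summit.AtomisticToContinuum.FouriersLaw.Theorems.AbelThermodynamicLimit.LoomisCompactHorizonWitness.stub_karamataRieszTwo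
      C Λ M hCm hM hV hAb, hAb, hEint, hCes, hmatch⟩

/-! ## The crux BY NAME -/

/-- **(R) on this line**: `StaticAbelianSqueeze.UniformAbelianRegularity` from the two physical stubs (open exactly through their `sorryAx`). -/
theorem uniformAbelianRegularity_skeleton :
    _root_.Summit.AtomisticToContinuum.FouriersLaw.Theses.StaticAbelianSqueeze.UniformAbelianRegularity :=
  uniformAbelianRegularity_of_abelSummableSplice_and_tails stub_abelSummableSplice stub_postCrossingTails

/-- **Skeleton theorem — the crux `HoelderEscapeProfile.AbelThermodynamicLimit` BY NAME** (stubs → (R) by the certificate above;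
(R) → CLB → crux by the landed p127832 `stub_cruxOfRegularityOfLowerBound`, which elaborates at this route's decl by `rfl`). -/
theorem AbelThermodynamicLimit_of :
    _root_.Summit.AtomisticToContinuum.FouriersLaw.Theses.HoelderEscapeProfile.AbelThermodynamicLimit :=
  Summit.AtomisticToContinuum.FouriersLaw.Theorems.AbelThermodynamicLimit.LoomisCompactHorizonWitness.stub_cruxOfRegularityOfLowerBound
    uniformAbelianRegularity_skeleton stub_conductanceLowerBound

/-- The same term closes the lead's copy `EmbeddedDrudeMourre.AbelThermodynamicLimit` (the item's registered crux decl). -/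
theorem AbelThermodynamicLimit_of' :
    _root_.Summit.AtomisticToContinuum.FouriersLaw.Theses.EmbeddedDrudeMourre.AbelThermodynamicLimit :=
  Summit.AtomisticToContinuum.FouriersLaw.Theorems.AbelThermodynamicLimit.LoomisCompactHorizonWitness.stub_cruxOfRegularityOfLowerBound
    uniformAbelianRegularity_skeleton stub_conductanceLowerBound

/-- The route copies of the crux are one proposition. -/
theorem crux_eq_twin :
    _root_.Summit.AtomisticToContinuum.FouriersLaw.Theses.HoelderEscapeProfile.AbelThermodynamicLimit =
      _root_.Summit.AtomisticToContinuum.FouriersLaw.Theses.EmbeddedDrudeMourre.AbelThermodynamicLimit := rfl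

end Summit.AtomisticToContinuum.FouriersLaw.Cruxes.AbelThermodynamicLimit.AbelSummableSplice

end
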